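import Summits.KontsevichZagierPeriods.KontsevichZagierPeriods.Theorems.SoloInformedUnderGraph
import Summits.KontsevichZagierPeriods.KontsevichZagierPeriods.Theorems.SoloInformedSmoothLocus
import Summits.KontsevichZagierPeriods.KontsevichZagierPeriods.Theorems.SoloInformedFibreScaling
import HarnessLib
import HarnessLib.Audit

/-!
# SoloInformed — density removal for the change-of-variables moves (COROLLARY NF.2, file C2 = tree file `SoloInformedDensityCoV`)

Solo programme `solo-KontsevichZagierPeriods-informed`, session s247 (K-NF.2, file C2).

**The statement.**  For a rule-(2) move `[σ, f] − [Φ(σ), g]` of the KZ calculus (`Φ` `ℚ`-semialgebraic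
on `σ`, differentiable along `σ` with derivative `Φ'`, injective, `f = (g ∘ Φ) · |det Φ'|`) the
regions under the graphs satisfy

  `[U(σ, f)] − [U(Φ(σ), g)] ∈ 𝒮`   (`soloInformed_under_sub_under_mem_scissorsRel`),

where `𝒮 = soloInformedScissorsRel` is generated by scissors moves and volume-preserving maps
between volume representations; hence `sub` of every rule-(2) move lies in `𝒮`
(`soloInformed_sub_mem_scissorsRel_of_mem_changeOfVariablesRel`).

**The proof.**  Let `G ⊆ σ` be the smooth locus of `Φ` (tree file `SoloInformedSmoothLocus`: open,
`ℚ`-semialgebraic, conull in `σ`, `Φ` is `C^∞` on `G` with `Φ' = DΦ` there) and `P = {x ∈ G | det Φ'(x)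
≠ 0}`.  Cut `U(σ, f)` over `P` and `Q = σ ∖ P`, and `U(Φ(σ), g)` over `P' = Φ(P)` and `Q' = Φ(σ) ∖ P'`
(scissors).  Over `P` the single map `Ψ(x, t) = (Φ x, t / |det Φ'(x)|)` (tree file
`SoloInformedFibreScaling`: `ℚ`-semialgebraic, injective, `|det DΨ| = 1`) carries `U(σ|P, f)` onto
`U(Φ(σ)|P', g)` — one volume-preserving map.  `U(σ|Q, f)` is null: over `σ ∖ G` it lies in a null
cylinder, over `{det Φ' = 0}` the integrand `f = (g ∘ Φ) · 0` vanishes.  `Q' ⊆ Φ(σ ∖ G) ∪ Φ({det Φ' = 0})`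
is null (image of a null set under a differentiable map; Sard in equal dimensions), so `U(Φ(σ)|Q', g)`
lies in a null cylinder.

References: M. Kontsevich, D. Zagier, *Periods* (2001), §1.2 rule (2); J. Cresson, J. Viu-Sos, JTNB 34
(2022), §§3–5; this work, `paper/nl-elimination.md` COROLLARY NF.2 (inputs F6, F8).
-/

noncomputable section

open scoped BigOperators Topology ContDiff

namespace Summit.KontsevichZagierPeriods.KontsevichZagierPeriods.Theorems

open Set MeasureTheory Function
open Literature.ModelTheory.ExponentialFields
open Literature.NumberTheory.Transcendental Literature.NumberTheory.Transcendental.KZ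

variable {n : ℕ}

/-! ### Null pieces -/

/-- The coordinate hyperplane `{last = 0}` of `ℝⁿ⁺¹` is null. [folklore] -/
theorem soloInformed_volume_setOf_last_eq_zero :
    volume {z : Fin (n + 1) → ℝ | z (Fin.last n) = 0} = 0 := by
  rw [volume_pi]
  exact Measure.pi_hyperplane _ _ _

/-- If the integrand of `s` vanishes off a null set `N` then the region under its graph is null (it
lies in the null cylinder over `N` united with the hyperplane `{t = 0}`). [folklore] -/
theorem soloInformed_volume_under_domain_eq_zero_of (s : IntegralRep n) {N : Set (Fin n → ℝ)}
    (hN : volume N = 0) (h0 : ∀ x ∈ s.domain, x ∉ N → s.integrand x = 0) :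
    volume (soloInformedUnder s).domain = 0 := by
  refine measure_mono_null (t := {z : Fin (n + 1) → ℝ | Fin.init z ∈ N} ∪
      {z : Fin (n + 1) → ℝ | z (Fin.last n) = 0}) (fun z hz => ?_)
    (measure_union_null (volume_setOf_init_mem_eq_zero hN) soloInformed_volume_setOf_last_eq_zero)
  obtain ⟨h1, h2, h3⟩ := (soloInformed_mem_under_domain s z).mp hz
  by_cases hxN : Fin.init z ∈ N
  · exact Or.inl hxN
  · right
    rw [h0 _ h1 hxN] at h3
    exact le_antisymm h3 h2

/-! ### Density removal for one change of variables -/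

/-- **`[U(σ, f)] − [U(Φ(σ), g)] ∈ 𝒮` for a rule-(2) move.**  See the module docstring for the proof
(smooth locus, one volume-preserving map `Ψ(x,t) = (Φ x, t/|det Φ'(x)|)` over the non-degenerate
part, null pieces by Sard). [Kontsevich–Zagier 2001, §1.2 rule (2); this work, COROLLARY NF.2] -/
theorem soloInformed_under_sub_under_mem_scissorsRel (r r' : IntegralRep n)
    {Φ : (Fin n → ℝ) → (Fin n → ℝ)} {Φ' : (Fin n → ℝ) → (Fin n → ℝ) →L[ℝ] (Fin n → ℝ)}
    (hΦ : IsSemialgebraicMapOn ℚ r.domain Φ)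
    (hd : ∀ x ∈ r.domain, HasFDerivWithinAt Φ (Φ' x) r.domain x) (hinj : InjOn Φ r.domain)
    (hdom : r'.domain = Φ '' r.domain)
    (hint : ∀ x ∈ r.domain, r.integrand x = r'.integrand (Φ x) * |(Φ' x).det|) :
    of (soloInformedUnder r) - of (soloInformedUnder r') ∈ soloInformedScissorsRel := by
  -- the smooth locus `G` of `Φ`
  obtain ⟨G, hGσ, hGo, hGsa, -, hσG0, hsm, hdG, -, -⟩ :=
    soloInformed_exists_jacobianLocus r.isSemialgebraic_domain hΦ hd
  -- the non-degenerate part `P` and its complement `Q`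
  set P : Set (Fin n → ℝ) := {x ∈ G | (Φ' x).det ≠ 0} with hP_def
  have hPo : IsOpen P := soloInformed_isOpen_sep_det_ne_zero hd hGσ hGo hsm
  have hPsa : IsSemialgebraic ℚ P :=
    (soloInformed_isSemialgebraic_sep_det r.isSemialgebraic_domain hΦ hd hGσ hGo hGsa).1
  have hPG : P ⊆ G := fun x hx => hx.1
  have hPσ : P ⊆ r.domain := hPG.trans hGσ
  set Q : Set (Fin n → ℝ) := r.domain \ P with hQ_def
  have hQsa : IsSemialgebraic ℚ Q := r.isSemialgebraic_domain.diff hPsa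
  have hQσ : Q ⊆ r.domain := Set.sdiff_subset
  have hcover : r.domain = P ∪ Q := (Set.union_sdiff_cancel hPσ).symm
  have hnull : volume (P ∩ Q) = 0 := by rw [hQ_def, Set.inter_sdiff_self]; exact measure_empty
  -- the image side `P' = Φ(P)`, `Q' = Φ(σ) ∖ P'`
  set P' : Set (Fin n → ℝ) := Φ '' P with hP'_def
  have hP'sa : IsSemialgebraic ℚ P' := IsSemialgebraicMapOn.isSemialgebraic_image_holds hΦ hPσ hPsa
  have hP'σ : P' ⊆ r'.domain := by rw [hdom]; exact image_mono hPσ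
  set Q' : Set (Fin n → ℝ) := r'.domain \ P' with hQ'_def
  have hQ'sa : IsSemialgebraic ℚ Q' := r'.isSemialgebraic_domain.diff hP'sa
  have hQ'σ : Q' ⊆ r'.domain := Set.sdiff_subset
  have hcover' : r'.domain = P' ∪ Q' := (Set.union_sdiff_cancel hP'σ).symm
  have hnull' : volume (P' ∩ Q') = 0 := by rw [hQ'_def, Set.inter_sdiff_self]; exact measure_empty
  -- (a), (b): the two cuts are scissors moves
  have ha := soloInformed_scissorsGen_subset_scissorsRel
    (soloInformed_under_restrict_mem_scissorsGen r hPsa hQsa hPσ hQσ hcover hnull)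
  have hb := soloInformed_scissorsGen_subset_scissorsRel
    (soloInformed_under_restrict_mem_scissorsGen r' hP'sa hQ'sa hP'σ hQ'σ hcover' hnull')
  -- (d): `U(σ|Q, f)` is null — `f` vanishes on `Q` off the null set `σ ∖ G`
  have hdQ : of (soloInformedUnder (r.restrict Q hQsa hQσ)) ∈ soloInformedScissorsRel := by
    refine soloInformed_of_mem_scissorsRel_of_volume_eq_zero (soloInformed_isVolRep_under _)
      (soloInformed_volume_under_domain_eq_zero_of _ hσG0 fun x hx hxN => ?_)
    have hxσ : x ∈ r.domain := hx.1
    have hxG : x ∈ G := by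
      by_contra hxG
      exact hxN ⟨hxσ, hxG⟩
    have hdet : (Φ' x).det = 0 := by
      by_contra hdet
      exact hx.2 ⟨hxG, hdet⟩
    show r.integrand x = 0
    rw [hint x hxσ, hdet, abs_zero, mul_zero]
  -- (e): `Q' ⊆ Φ(σ ∖ G) ∪ Φ({det Φ' = 0})` is null, so `U(Φ(σ)|Q', g)` is null
  have hQ'0 : volume Q' = 0 := by
    have h1 : volume (Φ '' (r.domain \ G)) = 0 :=
      addHaar_image_eq_zero_of_differentiableOn_of_addHaar_eq_zero volume
        (fun x hx => ((hd x hx.1).mono Set.sdiff_subset).differentiableWithinAt) hσG0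
    have h2 : volume (Φ '' {x ∈ G | (Φ' x).det = 0}) = 0 :=
      addHaar_image_eq_zero_of_det_fderivWithin_eq_zero volume
        (fun x hx => (hdG x hx.1).hasFDerivWithinAt) (fun x hx => hx.2)
    refine measure_mono_null (fun y hy => ?_) (measure_union_null h1 h2)
    obtain ⟨hyσ', hyP'⟩ := hy
    rw [hdom] at hyσ'
    obtain ⟨x, hxσ, rfl⟩ := hyσ'
    by_cases hxG : x ∈ G
    · right
      refine ⟨x, ⟨hxG, ?_⟩, rfl⟩
      by_contra hdet
      exact hyP' ⟨x, ⟨hxG, hdet⟩, rfl⟩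
    · exact Or.inl ⟨x, ⟨hxσ, hxG⟩, rfl⟩
  have heQ' : of (soloInformedUnder (r'.restrict Q' hQ'sa hQ'σ)) ∈ soloInformedScissorsRel :=
    soloInformed_of_mem_scissorsRel_of_volume_eq_zero (soloInformed_isVolRep_under _)
      (soloInformed_volume_under_domain_eq_zero_of _ hQ'0 fun x hx hxN => (hxN hx).elim)
  -- (c): the main piece — one volume-preserving map `Ψ(x,t) = (Φ x, t · h x)`, `h = |det Φ'|⁻¹`
  set h : (Fin n → ℝ) → ℝ := fun x => |(Φ' x).det|⁻¹ with hh_def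
  have hJ : ∀ x ∈ P, |(Φ' x).det| ≠ 0 := fun x hx => (abs_pos.mpr hx.2).ne'
  have hhpos : ∀ x ∈ P, 0 < h x := fun x hx => inv_pos.mpr (abs_pos.mpr hx.2)
  have hhsa : IsSemialgebraicFunOn ℚ P h :=
    ((soloInformed_isSemialgebraicFunOn_absDet r.isSemialgebraic_domain hΦ hd hGσ hGo hGsa).mono
      hPG hPsa).inv hJ
  have hhsm : ContDiffOn ℝ ∞ h P := (soloInformed_contDiffOn_absDet hd hGσ hGo hsm).inv hJ
  have hhd : ∀ x ∈ P, HasFDerivAt h (fderiv ℝ h x) x := fun x hx =>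
    (((hhsm.differentiableOn (by simp)) x hx).differentiableAt (hPo.mem_nhds hx)).hasFDerivAt
  have hSP : (soloInformedUnder (r.restrict P hPsa hPσ)).domain ⊆ {z | Fin.init z ∈ P} :=
    fun z hz => ((soloInformed_mem_under_domain _ z).mp hz).1
  have hc : of (soloInformedUnder (r.restrict P hPsa hPσ)) -
      of (soloInformedUnder (r'.restrict P' hP'sa hP'σ)) ∈ soloInformedMapGen := by
    refine soloInformed_mem_mapGen (soloInformed_isVolRep_under _) (soloInformed_isVolRep_under _)
      (soloInformedFibreMap Φ h)
      (fun z => soloInformedFibreMapDeriv (Φ' (Fin.init z)) h (fderiv ℝ h (Fin.init z)) z)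
      ?_ ?_ ?_ ?_ ?_
    · exact soloInformed_isSemialgebraicMapOn_fibreMap hPsa (hΦ.mono hPσ hPsa) hhsa
        (IntegralRep.isSemialgebraic_domain _) hSP
    · intro z hz
      exact (soloInformed_hasFDerivAt_fibreMap (hdG _ (hSP hz).1) (hhd _ (hSP hz))).hasFDerivWithinAt
    · exact soloInformed_injOn_fibreMap (hinj.mono hPσ) (fun x hx => (hhpos x hx).ne') hSP
    · have e1 : (soloInformedUnder (r.restrict P hPsa hPσ)).domain =
          {z : Fin (n + 1) → ℝ | Fin.init z ∈ P ∧ 0 ≤ z (Fin.last n) ∧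
            z (Fin.last n) ≤ r.integrand (Fin.init z)} := rfl
      have e2 : (soloInformedUnder (r'.restrict P' hP'sa hP'σ)).domain =
          {w : Fin (n + 1) → ℝ | Fin.init w ∈ Φ '' P ∧ 0 ≤ w (Fin.last n) ∧
            w (Fin.last n) ≤ r'.integrand (Fin.init w)} := rfl
      rw [e1, e2, soloInformed_fibreMap_image_under hhpos]
      intro x hx
      show r.integrand x * h x = r'.integrand (Φ x)
      rw [hint x (hPσ hx), hh_def, mul_assoc, mul_inv_cancel₀ (hJ x hx), mul_one]
    · intro z hz
      exact soloInformed_abs_det_fibreMapDeriv_eq_one _ z (hSP hz).2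
  have hc' := soloInformed_mapGen_subset_scissorsRel hc
  -- assembly
  have key : of (soloInformedUnder r) - of (soloInformedUnder r') =
      (of (soloInformedUnder r) - of (soloInformedUnder (r.restrict P hPsa hPσ)) -
          of (soloInformedUnder (r.restrict Q hQsa hQσ))) -
        (of (soloInformedUnder r') - of (soloInformedUnder (r'.restrict P' hP'sa hP'σ)) -
          of (soloInformedUnder (r'.restrict Q' hQ'sa hQ'σ))) +
        (of (soloInformedUnder (r.restrict P hPsa hPσ)) -
          of (soloInformedUnder (r'.restrict P' hP'sa hP'σ))) +
        of (soloInformedUnder (r.restrict Q hQsa hQσ)) -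
        of (soloInformedUnder (r'.restrict Q' hQ'sa hQ'σ)) := by
    abel
  rw [key]
  exact sub_mem (add_mem (add_mem (sub_mem ha hb) hc') hdQ) heQ'

/-- **Density removal for the moves (2).**  `sub` of a change-of-variables move lies in the scissors
group of relations `𝒮`: apply the previous theorem to `(r, r')` and to `(r⁻, r'⁻)` (same map `Φ`,
negated integrands). [this work, COROLLARY NF.2] -/
theorem soloInformed_sub_mem_scissorsRel_of_mem_changeOfVariablesRel {c : FormalRep}
    (hc : c ∈ changeOfVariablesRel) : soloInformedSub c ∈ soloInformedScissorsRel := by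
  obtain ⟨n, r, r', Φ, Φ', hΦ, hΦ', hinj, hdom, hf, rfl⟩ := hc
  rw [map_sub, soloInformed_sub_of, soloInformed_sub_of]
  have h1 := soloInformed_under_sub_under_mem_scissorsRel r r' hΦ hΦ' hinj hdom hf
  have h2 : of (soloInformedUnder r.neg) - of (soloInformedUnder r'.neg) ∈ soloInformedScissorsRel := by
    refine soloInformed_under_sub_under_mem_scissorsRel r.neg r'.neg (Φ := Φ) (Φ' := Φ') hΦ hΦ' hinj
      hdom fun x hx => ?_
    show -r.integrand x = -r'.integrand (Φ x) * |(Φ' x).det|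
    rw [hf x hx, neg_mul]
  have key : of (soloInformedUnder r) - of (soloInformedUnder r.neg) -
      (of (soloInformedUnder r') - of (soloInformedUnder r'.neg)) =
      of (soloInformedUnder r) - of (soloInformedUnder r') -
        (of (soloInformedUnder r.neg) - of (soloInformedUnder r'.neg)) := by
    abel
  rw [key]
  exact sub_mem h1 h2

end Summit.KontsevichZagierPeriods.KontsevichZagierPeriods.Theorems

end
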